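import Literature.NumberTheory.EllipticCurves.PAdicLFunction
import Literature.NumberTheory.EllipticCurves.QuadraticTwist
import Mathlib.NumberTheory.NumberField.Discriminant.Defs
import Mathlib.RingTheory.Ideal.Over
import HarnessLib

/-!
# The cyclotomic `p`-adic `L`-function of `E/ℚ` over an imaginary quadratic field `K`

Trunk T-NT-EC (Literature/NumberTheory/EllipticCurves); definition request `defn-padicLFunctionEK`
(route BirchSwinnertonDyer/PAdicOrder, cruxes #2/#5r4; consumer fact wi-03670, the `p`-adic
Gross–Zagier formula of Perrin-Riou 1987, Thm. 1.1).

**The object.** For an elliptic curve `E/ℚ` with newform `f`, a prime `p` of good ORDINARY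
reduction and an imaginary quadratic field `K` (discriminant `d_K`), the cyclotomic `p`-adic
`L`-function `L_p(E/K, T) ∈ ℚ_p⟦T⟧` is the Mazur–Mellin transform along the cyclotomic
`ℤ_p`-extension `K_∞^{cyc}/K` of the modular-symbol measure of `f` over `K` (Perrin-Riou 1987, §1,
after Mazur–Swinnerton-Dyer and Mazur–Tate–Teitelbaum 1986, §I; Haran 1987 for general number
fields), interpolating `L(E/K, χ∘N, 1)/Ω` for finite-order characters `χ` of `Gal(K_∞^{cyc}/K)`.

**What is defined here (flagged SHORTCUT, as sanctioned by the request).** By Artin formalism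
`L(E/K, χ∘N_{K/ℚ}, s) = L(E, χ, s) · L(E^{(d_K)}, χ, s)` with `E^{(d_K)}` the quadratic twist
(tree convention: `L(E/K, s) = L(E, s) L(E^{(d_K)}, s)`, cf. `Literature.NumberTheory.EllipticCurves.analyticRankEK`,
`Literature.NumberTheory.EllipticCurves.LDerivEK`), and correspondingly the cyclotomic `p`-adic `L`-function over `K` factors as
`L_p(E/K, T) = u · L_p(E, T) · L_p(E^{(d_K)}, T)` with `u` a `p`-adic unit (a ratio of periods
`Ω_{E/K} / (Ω⁺_E Ω⁺_{E^{(d)}})`, constant in `T`) when `p ∤ d_K`. We DEFINE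

  `padicLFunctionEK W p K hf hg := L_p(f, α, T) · L_p(g, χ_K(p) α, T)`,

the product of the tree's Mazur–Tate–Teitelbaum series (`Literature.NumberTheory.EllipticCurves.padicLFunction`,
`PAdicLFunction.lean`) of the newform `f` of `W` with unit root `α = unitRoot W p` and of the
newform `g` of the twist `W^{(d_K)}` with ITS unit root `χ_K(p) α` (`a_p(g) = χ_K(p) a_p(f)`, so
for `p` split in `K` both factors use `α`; for `p | d_K` the twist has bad reduction at `p` and the
value is junk). This fixes the period normalisation `Ω_{E/K} := Ω⁺_f Ω⁺_g` (i.e. `u = 1`); the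
comparison with Perrin-Riou's modular-symbols-over-`K` construction is NOT a Lean statement here
(no such construction in the tree) — consumers citing Perrin-Riou 1987 Thm. 1.1 must use her
normalisation modulo this unit.

* `quadCharAt p K = χ_K(p) ∈ {1, 0, -1}` (split / ramified / inert, via Mathlib
  `Ideal.primesOver` and `NumberField.discr`);
* `twistUnitRoot W p K = χ_K(p) · unitRoot W p`;
* `padicLFunctionEK`; the interpolation package `IsPAdicLFunctionEKOf f g p α α' L` (constant term
  `(1-α⁻¹)²(1-α'⁻¹)² [0]⁺_f [0]⁺_g`; at `χ(γ) - 1`: `(αα')⁻ᵐ S_f(χ) S_g(χ)`, the product of the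
  two MTT (14.3) right-hand sides, `S = ratTwistedSymbolSum`).
* PROVED: `padicLFunctionEK_of_split`, `constantCoeff_padicLFunctionEK`, and the constant-term
  clause of the interpolation from the two one-variable interpolation properties.

## Sources

* B. Perrin-Riou, *Points de Heegner et dérivées de fonctions `L` `p`-adiques*, Invent. Math. 89
  (1987) 455–510, §1 (the `p`-adic `L`-function of `E` over `K`, Thm. 1.1).
* B. Mazur, J. Tate, J. Teitelbaum, *On `p`-adic analogues of the conjectures of Birch and
  Swinnerton-Dyer*, Invent. Math. 84 (1986), §I.10–I.14.
* W. Stein, C. Wuthrich, *Algorithms for the arithmetic of elliptic curves using Iwasawa theory*,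
  Math. Comp. 82 (2013), §3 (normalisations of `L_p(E, T)`), §8 (quadratic twists).
-/

noncomputable section

open scoped MatrixGroups ModularForm
open CongruenceSubgroup NumberField Literature.NumberTheory.EllipticCurves.ModularForms

namespace Literature.NumberTheory.EllipticCurves

section Sign

variable (p : ℕ) (K : Type*) [Field K] [NumberField K]

open scoped Classical in
/-- `χ_K(p) ∈ {1, 0, -1}`: `1` if `p` splits in `K` (two primes of `𝓞 K` above `p`), `0` if
`p | d_K` (ramified), `-1` otherwise (inert) — the quadratic character of `K` at `p`, for `K`
quadratic. [Perrin-Riou 1987, §1 (notation `ε(p)`); Gross 1984, §3] [folklore] -/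
def quadCharAt : ℤ :=
  if ((Ideal.span {(p : ℤ)}).primesOver (𝓞 K)).ncard = 2 then 1
  else if (p : ℤ) ∣ NumberField.discr K then 0 else -1

/-- `p` splits in `K` ⇒ `χ_K(p) = 1`. [folklore] -/
theorem quadCharAt_of_split (h : ((Ideal.span {(p : ℤ)}).primesOver (𝓞 K)).ncard = 2) :
    quadCharAt p K = 1 := by
  simp [quadCharAt, h]

end Sign

section LFunction

variable (W : WeierstrassCurve ℚ) [W.IsGloballyMinimal] (p : ℕ) [Fact p.Prime]
  (K : Type*) [Field K] [NumberField K]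

/-- The unit root of the quadratic twist `E^{(d_K)}` at `p ∤ d_K`: `a_p(E^{(d_K)}) = χ_K(p) a_p(E)`,
so the unit root of `X² - a_p(E^{(d)}) X + p` is `χ_K(p) · α` (`α = unitRoot W p`); junk `0` for
`p | d_K`. [Mazur–Tate–Teitelbaum 1986, §I.11; Stein–Wuthrich 2013, §8] [folklore] -/
def twistUnitRoot : ℚ_[p] :=
  (quadCharAt p K : ℚ_[p]) * (unitRoot W p : ℚ_[p])

/-- `p` split in `K` ⇒ the twist has the same unit root `α`. [folklore] -/
theorem twistUnitRoot_of_split (h : ((Ideal.span {(p : ℤ)}).primesOver (𝓞 K)).ncard = 2) :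
    twistUnitRoot W p K = (unitRoot W p : ℚ_[p]) := by
  simp [twistUnitRoot, quadCharAt_of_split p K h]

variable {N N' : ℕ} [NeZero N] [NeZero N'] {f : CuspForm (Gamma0 N) 2} {g : CuspForm (Gamma0 N') 2}

/-- **The cyclotomic `p`-adic `L`-function of `E = W/ℚ` over the (imaginary quadratic) field `K`**,
`L_p(E/K, T) ∈ ℚ_p⟦T⟧`, in the FACTORISED normalisation (module doc):
`L_p(f, α, T) · L_p(g, χ_K(p)α, T)` for `f` the newform of `W`, `g` the newform of the quadratic
twist `W^{(d_K)}` (`d_K = NumberField.discr K`), `α = unitRoot W p`. The newforms are pinned by the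
anonymous proof arguments (modularity), as in `padicLFunctionE`. Intended regime: `p` good
ordinary for `W`, `p ∤ d_K` (for the consumer: `p` split in `K`). SHORTCUT for Perrin-Riou's
modular-symbol construction over `K`, to which it is equal up to a `p`-adic unit constant.
[Perrin-Riou 1987, §1; Mazur–Tate–Teitelbaum 1986, §I.13] [cite: PerrinRiou1987, §1] -/
def padicLFunctionEK (_hf : IsNewformOf W f)
    (_hg : IsNewformOf (W.quadraticTwist (NumberField.discr K : ℚ)) g) : PowerSeries ℚ_[p] :=
  padicLFunction f (unitRoot W p : ℚ_[p]) * padicLFunction g (twistUnitRoot W p K)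

omit [W.IsGloballyMinimal] in
/-- **Interpolation package for `L_p(E/K, T)`** relative to `(f, α)` and `(g, α')`: the product
form of MTT (14.3) for the two factors —
* `L(0) = (1 - α⁻¹)² (1 - α'⁻¹)² [0]⁺_f [0]⁺_g` (`= Euler factors · L(E/K, 1)/(Ω⁺_f Ω⁺_g)`), and
* for `χ` primitive of conductor `p^m`, `m ≥ 1`, even of `p`-power order:
  `L(χ(γ) - 1) = (α α')⁻ᵐ · S_f(χ) · S_g(χ)`, `S = ratTwistedSymbolSum` (`= τ(χ)² L(f,χ̄,1)
  L(g,χ̄,1)/(Ω⁺_f Ω⁺_g) = τ(χ)² L(E/K, χ̄∘N, 1)/(Ω⁺_f Ω⁺_g)` by Birch's formula and Artin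
  formalism). [Mazur–Tate–Teitelbaum 1986, §I.14 (14.3); Perrin-Riou 1987, §1] [cite: MazurTateTeitelbaum1986, §I.14  (14.3] -/
def IsPAdicLFunctionEKOf (f : CuspForm (Gamma0 N) 2) (g : CuspForm (Gamma0 N') 2) (p : ℕ)
    [Fact p.Prime] (α α' : ℚ_[p]) (L : PowerSeries ℚ_[p]) : Prop :=
  PowerSeries.constantCoeff L =
      (1 - α⁻¹) ^ 2 * (1 - α'⁻¹) ^ 2 * (ratPlusSymbol f 0 : ℚ_[p]) * (ratPlusSymbol g 0 : ℚ_[p]) ∧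
    ∀ (m : ℕ), 0 < m → ∀ χ : DirichletCharacter ℂ_[p] (p ^ m), χ.IsPrimitive → χ.Even →
      (∃ j : ℕ, orderOf χ = p ^ j) →
        HasSum (fun k : ℕ ↦ algebraMap ℚ_[p] ℂ_[p] (PowerSeries.coeff k L) *
            (χ (cyclotomicGenerator p : ZMod (p ^ m)) - 1) ^ k)
          (algebraMap ℚ_[p] ℂ_[p] ((α * α')⁻¹ ^ m) *
            (ratTwistedSymbolSum f χ * ratTwistedSymbolSum g χ))

/-! ### API -/

/-- For `p` split in `K`: `L_p(E/K, T) = L_p(f, α, T) · L_p(g, α, T)` — the factorisation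
`L_p(E/K) = L_p(E) · L_p(E^{(d_K)})` of the request, definitionally.
[Perrin-Riou 1987, §1] [folklore] -/
theorem padicLFunctionEK_of_split (hf : IsNewformOf W f)
    (hg : IsNewformOf (W.quadraticTwist (NumberField.discr K : ℚ)) g)
    (h : ((Ideal.span {(p : ℤ)}).primesOver (𝓞 K)).ncard = 2) :
    padicLFunctionEK W p K hf hg =
      padicLFunction f (unitRoot W p : ℚ_[p]) * padicLFunction g (unitRoot W p : ℚ_[p]) := by
  rw [padicLFunctionEK, twistUnitRoot_of_split W p K h]

/-- The first factor is the tree's `L_p(E, T)`. [folklore] -/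
theorem padicLFunctionEK_eq_padicLFunctionE_mul (hf : IsNewformOf W f)
    (hg : IsNewformOf (W.quadraticTwist (NumberField.discr K : ℚ)) g) :
    padicLFunctionEK W p K hf hg =
      padicLFunctionE W p hf * padicLFunction g (twistUnitRoot W p K) := rfl

/-- The constant term of `L_p(E/K, T)` is the product of the constant terms
`∫_{ℤ_p^×} dμ_{f,α} · ∫_{ℤ_p^×} dμ_{g,α'}`. [folklore] -/
theorem constantCoeff_padicLFunctionEK (hf : IsNewformOf W f)
    (hg : IsNewformOf (W.quadraticTwist (NumberField.discr K : ℚ)) g) :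
    PowerSeries.constantCoeff (padicLFunctionEK W p K hf hg) =
      padicLCoeff f (unitRoot W p : ℚ_[p]) 0 * padicLCoeff g (twistUnitRoot W p K) 0 := by
  rw [padicLFunctionEK, map_mul, constantCoeff_padicLFunction, constantCoeff_padicLFunction]

/-- The constant-term clause of `IsPAdicLFunctionEKOf` for `padicLFunctionEK` follows from the
one-variable interpolation properties of the two factors (the `χ`-clause needs the Cauchy product
of the two convergent evaluations and is not proved here). [Mazur–Tate–Teitelbaum 1986, §I.14] [folklore] -/
theorem constantCoeff_padicLFunctionEK_of_isPAdicLFunctionOf (hf : IsNewformOf W f)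
    (hg : IsNewformOf (W.quadraticTwist (NumberField.discr K : ℚ)) g)
    (h₁ : IsPAdicLFunctionOf f p (unitRoot W p : ℚ_[p]) (padicLFunction f (unitRoot W p : ℚ_[p])))
    (h₂ : IsPAdicLFunctionOf g p (twistUnitRoot W p K) (padicLFunction g (twistUnitRoot W p K))) :
    PowerSeries.constantCoeff (padicLFunctionEK W p K hf hg) =
      (1 - (unitRoot W p : ℚ_[p])⁻¹) ^ 2 * (1 - (twistUnitRoot W p K)⁻¹) ^ 2 *
        (ratPlusSymbol f 0 : ℚ_[p]) * (ratPlusSymbol g 0 : ℚ_[p]) := by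
  rw [padicLFunctionEK, map_mul, h₁.1, h₂.1]
  ring

end LFunction

end Literature.NumberTheory.EllipticCurves
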